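import Mathlib
import Summits.NavierStokesRegularity.NavierStokesRegularity.Theorems.AxisTwistDoorAveragedConeLiouvilleRegularOfFluxDecay
import Summits.NavierStokesRegularity.NavierStokesRegularity.Theorems.AxisTwistDoorTiltDominationLocEnergyClass
import Summits.NavierStokesRegularity.NavierStokesRegularity.Theorems.AxisTwistDoorTiltDominationLocPoloidalSlice
import Summits.NavierStokesRegularity.NavierStokesRegularity.Theorems.AxisTwistDoorTiltDominationLocSymmetryExclusions
import HarnessLib

/-!
# AxisTwistDoor · crux `TiltDominationLoc` (stmt-NavierStokesRegularity-26991, wall W3) — THE APEX FLUX OF THE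
# COUNTEREXAMPLE DOES NOT DECAY (modulo W4), and Lei–Ren–Tian's final step needs no cone

Helper file of the LEAD (ns-atd-p1 g5; `--supports stmt-NavierStokesRegularity-26991`).  No definitions.

Lei–Ren–Tian (arXiv:2501.08976, §3–4) use the pointwise cone `|ω| ≤ C ω₃` in three places: (1) the uniform bound on the
absolute flux `Γ(r,z,s) = ∫_{D(r,z)} ω₃` (their Lemma 3.1); (2) the one-sided SHELL INEQUALITY turning the disc identity
(their eq. Gamma-30) into the supersolution inequality eq. Gamma-34 on the REGULAR shell regions `𝒟₁ ∪ 𝒟₂`; (3) the last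
step «flux decay `sup_{𝒬(ρ)} Γ → 0` ⇒ the apex is regular» (Biot–Savart + ε-regularity, p. 12).  In the tree's
ONE-SIGNED Type-I class (`ω₃ ≥ 0`; crux 26889's line `lrt_shell`) step (3) was run WITH the circle cone
(`…RegularOfFluxDecay.regularOfFluxDecay`, via `…FlatFlux`).  This file removes the cone from step (3):

* `inner_curl_e3_eq_zero_of_circ_eq_zero` — on one slice `s < 0` of a class profile with `ω₃ ≥ 0`, vanishing axis
  circulation `Γ(r,z,s) = 0` for all `r > 0`, `z` forces `ω₃(s,·) ≡ 0` (Stokes `∂ᵣΓ = ∮ω₃`, the sign, analyticity).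
* `exists_poloidal_zoomLimit_of_fluxDecay` — a class profile with `ω₃ ≥ 0`, FLUX DECAY at the apex and a backward-
  singular apex has an apex zoom limit IN THE CLASS which is backward-singular (persistence) and POLOIDAL (`ω₃ ≡ 0` on
  the whole slab), together with the pointwise convergence of the zoomed vorticities (so every one-signed direction of
  `v` stays one-signed in the limit).
* `not_isBackwardSingularPoint_of_fluxDecay` — **modulo W4** (`PoloidalRigidity` ⟺ `StubNoPlanarCollar` ⟺ item 19708 in
  the energy class): `ω₃ ≥ 0` + flux decay ⇒ the apex is regular — NO CONE; and its contrapositive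
  `exists_flux_lower_bound_of_singular`: **the W3 counterexample has NON-DECAYING apex flux** — there is `κ > 0` such
  that EVERY apex window `{−ρ² < s < 0, 0 < r < ρ, |z| < ρ}` contains an axis circle with circulation `Γ ≥ κ`
  (portrait clause (xi); the tree's `…CounterexamplePortrait` had only `Γ > 0` somewhere in each window).
* `not_isBackwardSingularPoint_of_fluxDecay_of_flank` — **unconditionally** when the sign cone FLANKS `e₃`: if
  `⟪ω, e₃ + h⟫ ≥ 0` and `⟪ω, e₃ − h⟫ ≥ 0` for one horizontal `h ≠ 0` (equivalently the in-plane cone `|⟪ω, h⟫| ≤ ω₃`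
  with the out-of-plane component FREE — the «book about a horizontal spine» normal form of the residue rung
  `StubProperWedgeRigiditySat` of line `signcone`, bisector vertical), flux decay ⇒ regular apex: the poloidal zoom limit
  has `⟪ω,h⟫ ≡ 0` as well, so its vorticity is parallel to the spine `e₃ × h` and Barker–Prange
  (`…SymmetryExclusions.not_isBackwardSingularPoint_of_curl_parallel_slice`) applies.  Contrapositive
  `exists_flux_lower_bound_of_singular_of_flank`.

CONSEQUENCE FOR THE WALL (census, not a theorem): modulo W4, crux 26991 is EXACTLY «flux decay at the apex for one-signed
Type-I profiles», and in Lei–Ren–Tian's scheme the only remaining use of a cone is the shell inequality (2) — the control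
of the twisting term `∮_{S(r,z)} ω_r (v₃ − v̄₃) dl = −r ∮ ∂_z v_θ (v₃ − v̄₃) dθ` on circles of the REGULAR shell by
`C(K) ∮ ω₃ dl` (the flux bound (1) is free under the sign: `Γ(r,z,s) ≤ Γ(a,z,s) ≤ 2πa · sup_shell |v|` by monotonicity).

HONEST FRAMING: statements about HYPOTHETICAL Type-I blow-up profiles; W3 (26991), W4 (19708), the leaf
`HalfSpaceWindowDoor.Target` and Navier–Stokes regularity (Clay A) are OPEN; nothing here is an NS regularity statement.
[cite: LeiRenTian2025, §4 pp. 11–12 (eq. Gamma-decay and the last paragraph of the proof of Prop. 3.3)]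
[cite: KochNadirashviliSereginSverak2009, §4–6 (compactness of the Type-I ancient mild class)]
[cite: BarkerPrange2020Alignment, Prop. 4 and Remark 5]
-/

noncomputable section

-- the summit and its single sub-problem share the name (CONVENTIONS §1), as in every Theorems file
set_option linter.dupNamespace false

namespace Summit.NavierStokesRegularity.NavierStokesRegularity.Theorems.AxisTwistDoorTiltDominationLocFluxNondecay

open scoped Topology InnerProductSpace NNReal ENNReal
open Set Function MeasureTheory Filter Metric
open Literature.Analysis
open Literature.Analysis.FluidPDE hiding eR
open Summit.NavierStokesRegularity.NavierStokesRegularity.Theorems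
open Summit.NavierStokesRegularity.NavierStokesRegularity.Theorems.AxisTwistDoorAveragedConeLiouvilleDefs
open Summit.NavierStokesRegularity.NavierStokesRegularity.Theorems.AveragedConeLiouvilleProfileZoom
open Summit.NavierStokesRegularity.NavierStokesRegularity.Theorems.AveragedConeLiouville.CircleStokes
  (inner_e3 deriv_circ_eq_vortCirc)
open Summit.NavierStokesRegularity.NavierStokesRegularity.Theorems.AveragedConeLiouville.FlatFlux
  (eq_zero_of_integral_eq_zero_of_nonneg exists_cylPt_eq)
open Summit.NavierStokesRegularity.NavierStokesRegularity.Theorems.AxisTwistDoorAveragedConeLiouvilleCylFrame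
  (continuous_cylPt_θ)
open Summit.NavierStokesRegularity.NavierStokesRegularity.Theorems.PoloidalWindowDoorPoloidalWindowRigidityClassSpaceTimeRates
  (exists_fderiv_rate_of_class')
open Summit.NavierStokesRegularity.NavierStokesRegularity.Theorems.AxisTwistDoorTiltDominationLocDefs (PoloidalRigidity)
open Summit.NavierStokesRegularity.NavierStokesRegularity.Theorems.AxisTwistDoorTiltDominationLocEnergyClass
  (poloidalRigidity_iff_typeI exists_energyClass_of_typeI)
open Summit.NavierStokesRegularity.NavierStokesRegularity.Theorems.AxisTwistDoorTiltDominationLocPoloidalSlice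
  (omega3_slice_eq_zero_of_eqOn_open)
open Summit.NavierStokesRegularity.NavierStokesRegularity.Theorems.AxisTwistDoorTiltDominationLocSymmetryExclusions
  (not_isBackwardSingularPoint_of_curl_parallel_slice)

variable {C : ℝ} {v : ℝ → EuclideanSpace ℝ (Fin 3) → EuclideanSpace ℝ (Fin 3)}
  {π : ℝ → EuclideanSpace ℝ (Fin 3) → ℝ}
  {H : ℝ → EuclideanSpace ℝ (Fin 3) → EuclideanSpace ℝ (Fin 3) →L[ℝ] EuclideanSpace ℝ (Fin 3)}

/-! ### §1 Vanishing axis circulation on a slice kills `ω₃` on the slice -/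

/-- **`Γ(·, ·, s) ≡ 0` on one slice ⇒ `ω₃(s, ·) ≡ 0`.**  For a class profile (Type-I rate, continuity on the open slab,
Oseen identity — slices are real-analytic) with `ω₃ ≥ 0` on the slice `s < 0`: if the axis circulation `Γ(r,z,s)`
vanishes for all `r > 0` and all heights `z`, then `ω₃` vanishes identically on that slice.  (Stokes in the radius,
`∂ᵣΓ = ∮_{S(r,z)} ω₃ dl`; the non-negative continuous integrand vanishes on every axis circle, i.e. on the open
half-space `{y₁ > 0}` off the axis; analyticity of the slice globalises.) [cite: LeiRenTian2025, §4 p. 11 (Γ as the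
flux of ω₃ through discs)] -/
theorem inner_curl_e3_eq_zero_of_circ_eq_zero (hrate : HasTypeITimeDecay C v)
    (hcont : ContinuousOn (uncurry v) (Iio (0 : ℝ) ×ˢ univ))
    (hmild : ∀ s t : ℝ, s < t → t < 0 → ∀ x,
      v t x = UnboundedOperators.heatExtension (v s) (t - s) x - oseenDuhamel 1 s v v t x)
    {s : ℝ} (hs : s < 0) (hsign : ∀ y, 0 ≤ ⟪curl (v s) y, e3⟫_ℝ)
    (hcirc : ∀ r : ℝ, 0 < r → ∀ z : ℝ, circ v r z s = 0) :
    ∀ y, ⟪curl (v s) y, (EuclideanSpace.single (2 : Fin 3) (1 : ℝ))⟫_ℝ = 0 := by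
  have hv : ContDiff ℝ 1 (v s) := contDiff_one_slice hrate hcont hmild hs
  -- `∮_{S(r,z)} ω₃ dl = ∂ᵣΓ(r,z,s) = 0` for `r > 0`
  have hvort : ∀ r : ℝ, 0 < r → ∀ z : ℝ, vortCirc v r z s = 0 := by
    intro r hr z
    have hev : (fun r' => circ v r' z s) =ᶠ[𝓝 r] fun _ => (0 : ℝ) := by
      filter_upwards [isOpen_Ioi.mem_nhds hr] with r' hr'
      exact hcirc r' hr' z
    rw [← deriv_circ_eq_vortCirc v hv r z, hev.deriv_eq, deriv_const]
  -- `ω₃ = 0` on every axis circle, off the closed half-plane `θ = 0`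
  have hcircle : ∀ r : ℝ, 0 < r → ∀ z θ : ℝ, θ ∈ Ioo (0 : ℝ) (2 * Real.pi) →
      ⟪curl (v s) (cylPt r θ z), e3⟫_ℝ = 0 := by
    intro r hr z θ hθ
    have hωc : Continuous fun θ => curl (v s) (cylPt r θ z) := (continuous_curl hv).comp (continuous_cylPt_θ r z)
    have hfc : Continuous fun θ => ⟪curl (v s) (cylPt r θ z), e3⟫_ℝ * r :=
      (hωc.inner continuous_const).mul continuous_const
    have hint : ∫ θ in (0 : ℝ)..(2 * Real.pi), ⟪curl (v s) (cylPt r θ z), e3⟫_ℝ * r = 0 := hvort r hr z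
    have h := eq_zero_of_integral_eq_zero_of_nonneg hfc (fun θ => mul_nonneg (hsign _) hr.le) hint hθ
    exact (mul_eq_zero.1 h).resolve_right hr.ne'
  -- hence on the open half-space `{y₁ > 0}`, and by analyticity everywhere
  have hO : IsOpen {y : EuclideanSpace ℝ (Fin 3) | 0 < y 1} := isOpen_lt continuous_const (EuclideanSpace.proj 1).continuous
  have hne : ({y : EuclideanSpace ℝ (Fin 3) | 0 < y 1}).Nonempty :=
    ⟨EuclideanSpace.single (1 : Fin 3) (1 : ℝ), by simp⟩
  refine omega3_slice_eq_zero_of_eqOn_open hrate hcont hmild hs hO hne fun y hy => ?_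
  obtain ⟨r, θ, hr, -, hθ, hyeq⟩ := exists_cylPt_eq (y := y) hy
  rw [← hyeq]
  exact hcircle r hr (y 2) θ hθ

/-! ### §2 The poloidal zoom limit of a profile with decaying apex flux -/

/-- **Flux decay makes the apex zoom limit poloidal.**  Let `v` be a profile of the route's energy class with `ω₃ ≥ 0`,
FLUX DECAY at the apex (`sup_{𝒬(ρ)} Γ → 0`) and a backward-singular apex.  Then along some scales `λⱼ → 0⁺` the apex
zooms `λⱼ v(λⱼ² s, λⱼ y)` have a limit `v₁` which is again a Type-I ancient Oseen-mild profile (rate `C`), is BACKWARD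
SINGULAR at the apex (persistence of singularities, inside `profileZoomFrame`), whose vorticity is the pointwise limit of
the zoomed vorticities, and which is POLOIDAL: `⟪curl v₁(s) y, e₃⟫ = 0` for all `s < 0`, `y` (its axis circulation is
`Γ_{v₁}(R,z,s) = lim Γ_v(λⱼR, λⱼz, λⱼ²s) = 0`, `…RegularOfFluxDecay.circ_zoomLimit_eq_zero`, then §1 on every slice).
[cite: LeiRenTian2025, §4 p. 12; KochNadirashviliSereginSverak2009, §6; AlbrittonBarker2019, Prop. 2.3] -/
theorem exists_poloidal_zoomLimit_of_fluxDecay (hcl : InClass C v π H) (hsign : SignE3 v) (hflux : FluxDecay v)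
    (hsing : IsBackwardSingularPoint v 0) :
    ∃ (lam : ℕ → ℝ) (v₁ : ℝ → EuclideanSpace ℝ (Fin 3) → EuclideanSpace ℝ (Fin 3)),
      (∀ j, 0 < lam j) ∧ Tendsto lam atTop (𝓝 0) ∧
      (HasTypeITimeDecay C v₁ ∧ ContinuousOn (uncurry v₁) (Iio (0 : ℝ) ×ˢ univ) ∧
        (∀ s t : ℝ, s < t → t < 0 → ∀ x,
          v₁ t x = UnboundedOperators.heatExtension (v₁ s) (t - s) x - oseenDuhamel 1 s v₁ v₁ t x) ∧
        (∀ t < 0, VectorCalculus.IsDivFree (v₁ t))) ∧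
      IsBackwardSingularPoint v₁ 0 ∧
      (∀ s < 0, ∀ y, Tendsto (fun j => (lam j) ^ 2 • curl (v ((lam j) ^ 2 * s)) ((lam j) • y)) atTop
        (𝓝 (curl (v₁ s) y))) ∧
      (∀ s < 0, ∀ y, ⟪curl (v₁ s) y, (EuclideanSpace.single (2 : Fin 3) (1 : ℝ))⟫_ℝ = 0) := by
  have hC : 0 ≤ C := by
    have h := hcl.decay (-1) (by norm_num) 0
    rw [neg_neg, Real.sqrt_one, div_one] at h
    exact (norm_nonneg _).trans h
  obtain ⟨πn, lam, w, v₁, ϖ, H', Ks, r₁, -, hlam, hlam0, hball1, hr₁, hr₁1, hKs, hL3, -, hae, hP, hsing₁⟩ :=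
    profileZoomFrame hC hcl.decay hcl.suitable hcl.weakGrad hcl.typeI hsing
  -- pointwise convergence of the zoomed vorticities
  have hzoom : ∀ s < 0, ∀ y, Tendsto (fun j => (lam j) ^ 2 • curl (v ((lam j) ^ 2 * s)) ((lam j) • y)) atTop
      (𝓝 (curl (v₁ s) y)) :=
    fun s hs y => profileZoom_curl_tendsto hcl.decay hcl.cont hball1 hlam hlam0 hr₁ hr₁1 hKs hL3 hae hP s hs y
  obtain ⟨hrate₁, hcont₁, hmild₁, hdiv₁⟩ := hP
  -- regularity of slices and the class gradient rate of `v`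
  have hv : ∀ t < 0, ContDiff ℝ 1 (v t) := fun t ht => contDiff_one_slice hcl.decay hcl.cont hcl.mild ht
  have hv₁ : ∀ t < 0, ContDiff ℝ 1 (v₁ t) := fun t ht => contDiff_one_slice hrate₁ hcont₁ hmild₁ ht
  obtain ⟨Kd, -, hgrad⟩ := exists_fderiv_rate_of_class' hcl.decay hcl.cont hcl.mild
  -- the sign passes to the limit
  have hsign₁ : SignE3 v₁ := fun s hs y => inner_curl_nonneg_of_profileZoom hsign hzoom hlam s hs y
  -- the axis circulation of the limit vanishes on every slice, hence `ω₃ ≡ 0`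
  have hcirc : ∀ s < 0, ∀ r : ℝ, 0 < r → ∀ z : ℝ, circ v₁ r z s = 0 := fun s hs r hr z =>
    circ_zoomLimit_eq_zero hlam hlam0 hzoom hv hv₁ hgrad hsign hflux hs hr.le z
  have hpol : ∀ s < 0, ∀ y, ⟪curl (v₁ s) y, (EuclideanSpace.single (2 : Fin 3) (1 : ℝ))⟫_ℝ = 0 :=
    fun s hs => inner_curl_e3_eq_zero_of_circ_eq_zero hrate₁ hcont₁ hmild₁ hs (hsign₁ s hs) (hcirc s hs)
  exact ⟨lam, v₁, hlam, hlam0, ⟨hrate₁, hcont₁, hmild₁, hdiv₁⟩, hsing₁, hzoom, hpol⟩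

/-! ### §3 Modulo W4: flux decay ⇒ regular apex (no cone), and the counterexample's flux does not decay -/

/-- **Lei–Ren–Tian's final step without the cone, modulo W4.**  Assume `PoloidalRigidity` (⟺ `StubNoPlanarCollar` ⟺ the
shared poloidal Liouville item 19708 read in the energy class).  Then a profile of the route's energy class with `ω₃ ≥ 0`
and FLUX DECAY at the apex is NOT backward-singular there: otherwise §2 produces a poloidal backward-singular zoom limit
in the class, which `PoloidalRigidity` forbids.  (The tree's `…RegularOfFluxDecay.regularOfFluxDecay` needs the
slack-free circle cone `GlobalCone v` instead of W4.) [cite: LeiRenTian2025, §4 p. 12] -/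
theorem not_isBackwardSingularPoint_of_fluxDecay (hP : PoloidalRigidity) (hcl : InClass C v π H) (hsign : SignE3 v)
    (hflux : FluxDecay v) : ¬ IsBackwardSingularPoint v 0 := by
  intro hsing
  obtain ⟨lam, v₁, -, -, ⟨hrate₁, hcont₁, hmild₁, hdiv₁⟩, hsing₁, -, hpol⟩ :=
    exists_poloidal_zoomLimit_of_fluxDecay hcl hsign hflux hsing
  exact (poloidalRigidity_iff_typeI.1 hP) C v₁ hrate₁ hcont₁ hmild₁ hdiv₁ hpol hsing₁

/-- **Core-class form** (the energy class is automatic, `…EnergyClass.exists_energyClass_of_typeI`): modulo W4, a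
Type-I ancient Oseen-mild profile with `ω₃ ≥ 0` and decaying apex flux is not backward-singular at the apex. -/
theorem not_isBackwardSingularPoint_of_fluxDecay_core (hP : PoloidalRigidity) (hrate : HasTypeITimeDecay C v)
    (hcont : ContinuousOn (uncurry v) (Iio (0 : ℝ) ×ˢ univ))
    (hmild : ∀ s t : ℝ, s < t → t < 0 → ∀ x,
      v t x = UnboundedOperators.heatExtension (v s) (t - s) x - oseenDuhamel 1 s v v t x)
    (hdiv : ∀ t < 0, VectorCalculus.IsDivFree (v t)) (hsign : SignE3 v) (hflux : FluxDecay v) :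
    ¬ IsBackwardSingularPoint v 0 := by
  obtain ⟨π, H, hsw, hwg, hI⟩ := exists_energyClass_of_typeI hrate hcont hmild hdiv
  exact not_isBackwardSingularPoint_of_fluxDecay hP ⟨hrate, hcont, hmild, hdiv, hsw, hwg, hI⟩ hsign hflux

/-- **THE APEX FLUX OF THE W3 COUNTEREXAMPLE DOES NOT DECAY (modulo W4).**  Assume `PoloidalRigidity`.  A Type-I
ancient Oseen-mild profile with `ω₃ ≥ 0` which IS backward-singular at the apex — the hypothetical counterexample to
crux 26991 in core form (`…EnergyClass.oneSignedRigidity_iff_core`) — carries axis circulation BOUNDED BELOW AT ALL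
SCALES: there is `κ > 0` such that every apex window `{−ρ² < s < 0, 0 < r < ρ, |z| < ρ}` contains an axis circle
`S(r,z)` at a time `s` with `Γ(r,z,s) = ∮_{S(r,z)} v(s)·e_θ dl ≥ κ`.  (Scale-invariantly: `inf_ρ sup_{𝒬(ρ)} Γ > 0`;
with the Type-I bound `Γ(r,z,s) ≤ 2πr·C(−s)^{−1/2}` such circles have `r ≥ κ√(−s)/(2πC)` — they sit at or outside
the parabolic scale.) [cite: LeiRenTian2025, §4 eq. (Gamma-decay)/(kappa), p. 11] -/
theorem exists_flux_lower_bound_of_singular (hP : PoloidalRigidity) (hrate : HasTypeITimeDecay C v)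
    (hcont : ContinuousOn (uncurry v) (Iio (0 : ℝ) ×ˢ univ))
    (hmild : ∀ s t : ℝ, s < t → t < 0 → ∀ x,
      v t x = UnboundedOperators.heatExtension (v s) (t - s) x - oseenDuhamel 1 s v v t x)
    (hdiv : ∀ t < 0, VectorCalculus.IsDivFree (v t)) (hsign : SignE3 v) (hsing : IsBackwardSingularPoint v 0) :
    ∃ κ : ℝ, 0 < κ ∧ ∀ ρ : ℝ, 0 < ρ →
      ∃ s r z : ℝ, -ρ ^ 2 < s ∧ s < 0 ∧ 0 < r ∧ r < ρ ∧ |z| < ρ ∧ κ ≤ circ v r z s := by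
  have h := not_isBackwardSingularPoint_of_fluxDecay_core hP hrate hcont hmild hdiv hsign
  by_contra hcon
  refine h (fun κ hκ => ?_) hsing
  by_contra hρ
  refine hcon ⟨κ, hκ, fun ρ hρ' => ?_⟩
  by_contra hwin
  refine hρ ⟨ρ, hρ', fun s r z h1 h2 h3 h4 h5 => ?_⟩
  by_contra hlt
  exact hwin ⟨s, r, z, h1, h2, h3, h4, h5, not_lt.1 hlt⟩

/-! ### §4 Unconditionally, when the sign cone flanks `e₃` (the «book» normal form of the residue rung) -/

/-- Linear algebra in `ℝ³`: a vector orthogonal to `e₃` and to a non-zero horizontal `h` is a multiple of the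
horizontal vector `h^⊥ = (−h₁, h₀, 0)`. -/
theorem exists_smul_perp_of_inner_eq_zero {ω h : EuclideanSpace ℝ (Fin 3)} (hh : h ≠ 0) (hh3 : h 2 = 0)
    (hω3 : ω 2 = 0) (hωh : ⟪ω, h⟫_ℝ = 0) :
    ∃ a : ℝ, ω = a • (WithLp.toLp 2 ![-(h 1), h 0, 0] : EuclideanSpace ℝ (Fin 3)) := by
  have hωh' : ω 0 * h 0 + ω 1 * h 1 = 0 := by
    have : ⟪ω, h⟫_ℝ = ∑ i, ω i * h i := by
      simp [EuclideanSpace.inner_eq_star_dotProduct, dotProduct, mul_comm]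
    rw [this, Fin.sum_univ_three, hh3, mul_zero, add_zero] at hωh
    exact hωh
  have hpos : 0 < h 0 ^ 2 + h 1 ^ 2 := by
    by_contra hle
    push Not at hle
    apply hh
    have h0 : h 0 = 0 := by nlinarith [sq_nonneg (h 0), sq_nonneg (h 1)]
    have h1 : h 1 = 0 := by nlinarith [sq_nonneg (h 0), sq_nonneg (h 1)]
    ext i
    fin_cases i
    · simpa using h0
    · simpa using h1
    · simpa using hh3
  refine ⟨(ω 1 * h 0 - ω 0 * h 1) / (h 0 ^ 2 + h 1 ^ 2), ?_⟩
  ext i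
  fin_cases i
  · simp
    field_simp
    linear_combination (h 0) * hωh'
  · simp
    field_simp
    linear_combination (h 1) * hωh'
  · simp [hω3]

/-- **Flux decay ⇒ regular apex when the sign cone flanks `e₃` — NO W4.**  Let `v` be a profile of the route's energy
class whose vorticity is one-signed against `e₃ + h` AND against `e₃ − h` for one horizontal `h ≠ 0` (so `ω₃ ≥ |⟪ω,h⟫|`:
the in-plane cone of the «book» normal form of the residue rung `StubProperWedgeRigiditySat` of line `signcone`, the
component along the spine `e₃ × h` being free).  If the apex flux decays, the apex is NOT backward-singular: the
poloidal zoom limit of §2 keeps both one-signed directions (`inner_curl_nonneg_of_profileZoom`), so `⟪ω,h⟫ ≡ 0 ≡ ω₃`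
there, its vorticity is everywhere parallel to the spine, and Barker–Prange's criterion
(`…SymmetryExclusions.not_isBackwardSingularPoint_of_curl_parallel_slice`) contradicts the persistence of the
singularity. [cite: LeiRenTian2025, §4 p. 12; BarkerPrange2020Alignment, Prop. 4 and Remark 5 (arXiv:1906.08225 p. 5)] -/
theorem not_isBackwardSingularPoint_of_fluxDecay_of_flank (hcl : InClass C v π H) {h : EuclideanSpace ℝ (Fin 3)}
    (hh : h ≠ 0) (hh3 : h 2 = 0)
    (hplus : ∀ s < 0, ∀ y, 0 ≤ ⟪curl (v s) y, EuclideanSpace.single (2 : Fin 3) (1 : ℝ) + h⟫_ℝ)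
    (hminus : ∀ s < 0, ∀ y, 0 ≤ ⟪curl (v s) y, EuclideanSpace.single (2 : Fin 3) (1 : ℝ) - h⟫_ℝ)
    (hflux : FluxDecay v) : ¬ IsBackwardSingularPoint v 0 := by
  intro hsing
  -- `ω₃ ≥ 0` is the average of the two flank inequalities
  have hsign : SignE3 v := by
    intro s hs y
    have h1 := hplus s hs y
    have h2 := hminus s hs y
    rw [inner_add_right] at h1
    rw [inner_sub_right] at h2
    linarith
  obtain ⟨lam, v₁, hlam, -, ⟨hrate₁, hcont₁, hmild₁, hdiv₁⟩, hsing₁, hzoom, hpol⟩ :=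
    exists_poloidal_zoomLimit_of_fluxDecay hcl hsign hflux hsing
  have hplus₁ : ∀ s < 0, ∀ y, 0 ≤ ⟪curl (v₁ s) y, EuclideanSpace.single (2 : Fin 3) (1 : ℝ) + h⟫_ℝ :=
    fun s hs y => inner_curl_nonneg_of_profileZoom hplus hzoom hlam s hs y
  have hminus₁ : ∀ s < 0, ∀ y, 0 ≤ ⟪curl (v₁ s) y, EuclideanSpace.single (2 : Fin 3) (1 : ℝ) - h⟫_ℝ :=
    fun s hs y => inner_curl_nonneg_of_profileZoom hminus hzoom hlam s hs y
  -- on the slice `s = −1` the limit vorticity is orthogonal to `e₃` and to `h`, hence parallel to the spine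
  have hpar : ∀ y, ∃ a : ℝ, curl (v₁ (-1)) y = a • (WithLp.toLp 2 ![-(h 1), h 0, 0] : EuclideanSpace ℝ (Fin 3)) := by
    intro y
    have h3 : ⟪curl (v₁ (-1)) y, EuclideanSpace.single (2 : Fin 3) (1 : ℝ)⟫_ℝ = 0 := hpol (-1) (by norm_num) y
    have hp := hplus₁ (-1) (by norm_num) y
    have hm := hminus₁ (-1) (by norm_num) y
    rw [inner_add_right, h3, zero_add] at hp
    rw [inner_sub_right, h3, zero_sub] at hm
    have hωh : ⟪curl (v₁ (-1)) y, h⟫_ℝ = 0 := le_antisymm (by linarith) hp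
    have hω3 : curl (v₁ (-1)) y 2 = 0 := by
      rw [← h3, EuclideanSpace.inner_single_right]; simp
    exact exists_smul_perp_of_inner_eq_zero hh hh3 hω3 hωh
  have hn : (WithLp.toLp 2 ![-(h 1), h 0, 0] : EuclideanSpace ℝ (Fin 3)) ≠ 0 := by
    intro h0
    apply hh
    have e0 : h 0 = 0 := by
      have := congrArg (fun w : EuclideanSpace ℝ (Fin 3) => w 1) h0
      simpa using this
    have e1 : h 1 = 0 := by
      have := congrArg (fun w : EuclideanSpace ℝ (Fin 3) => w 0) h0
      simpa using this
    ext i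
    fin_cases i
    · simpa using e0
    · simpa using e1
    · simpa using hh3
  exact not_isBackwardSingularPoint_of_curl_parallel_slice hrate₁ hcont₁ hmild₁ hdiv₁ (by norm_num : (-1 : ℝ) < 0)
    hn hpar hsing₁

/-- **Core-class form of §4.** -/
theorem not_isBackwardSingularPoint_of_fluxDecay_of_flank_core (hrate : HasTypeITimeDecay C v)
    (hcont : ContinuousOn (uncurry v) (Iio (0 : ℝ) ×ˢ univ))
    (hmild : ∀ s t : ℝ, s < t → t < 0 → ∀ x,
      v t x = UnboundedOperators.heatExtension (v s) (t - s) x - oseenDuhamel 1 s v v t x)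
    (hdiv : ∀ t < 0, VectorCalculus.IsDivFree (v t)) {h : EuclideanSpace ℝ (Fin 3)} (hh : h ≠ 0) (hh3 : h 2 = 0)
    (hplus : ∀ s < 0, ∀ y, 0 ≤ ⟪curl (v s) y, EuclideanSpace.single (2 : Fin 3) (1 : ℝ) + h⟫_ℝ)
    (hminus : ∀ s < 0, ∀ y, 0 ≤ ⟪curl (v s) y, EuclideanSpace.single (2 : Fin 3) (1 : ℝ) - h⟫_ℝ)
    (hflux : FluxDecay v) : ¬ IsBackwardSingularPoint v 0 := by
  obtain ⟨π, H, hsw, hwg, hI⟩ := exists_energyClass_of_typeI hrate hcont hmild hdiv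
  exact not_isBackwardSingularPoint_of_fluxDecay_of_flank ⟨hrate, hcont, hmild, hdiv, hsw, hwg, hI⟩ hh hh3 hplus hminus
    hflux

/-- **The «book» counterexample has non-decaying apex flux — unconditionally.**  A Type-I ancient Oseen-mild profile,
backward-singular at the apex, whose vorticity is one-signed against `e₃ ± h` for a horizontal `h ≠ 0` (the residue
rung of line `signcone` in normal position) carries axis circulation `Γ ≥ κ > 0` on some circle of every apex window.
[cite: LeiRenTian2025, §4 eq. (Gamma-decay)/(kappa), p. 11] -/
theorem exists_flux_lower_bound_of_singular_of_flank (hrate : HasTypeITimeDecay C v)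
    (hcont : ContinuousOn (uncurry v) (Iio (0 : ℝ) ×ˢ univ))
    (hmild : ∀ s t : ℝ, s < t → t < 0 → ∀ x,
      v t x = UnboundedOperators.heatExtension (v s) (t - s) x - oseenDuhamel 1 s v v t x)
    (hdiv : ∀ t < 0, VectorCalculus.IsDivFree (v t)) {h : EuclideanSpace ℝ (Fin 3)} (hh : h ≠ 0) (hh3 : h 2 = 0)
    (hplus : ∀ s < 0, ∀ y, 0 ≤ ⟪curl (v s) y, EuclideanSpace.single (2 : Fin 3) (1 : ℝ) + h⟫_ℝ)
    (hminus : ∀ s < 0, ∀ y, 0 ≤ ⟪curl (v s) y, EuclideanSpace.single (2 : Fin 3) (1 : ℝ) - h⟫_ℝ)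
    (hsing : IsBackwardSingularPoint v 0) :
    ∃ κ : ℝ, 0 < κ ∧ ∀ ρ : ℝ, 0 < ρ →
      ∃ s r z : ℝ, -ρ ^ 2 < s ∧ s < 0 ∧ 0 < r ∧ r < ρ ∧ |z| < ρ ∧ κ ≤ circ v r z s := by
  have h := not_isBackwardSingularPoint_of_fluxDecay_of_flank_core hrate hcont hmild hdiv hh hh3 hplus hminus
  by_contra hcon
  refine h (fun κ hκ => ?_) hsing
  by_contra hρ
  refine hcon ⟨κ, hκ, fun ρ hρ' => ?_⟩
  by_contra hwin
  refine hρ ⟨ρ, hρ', fun s r z h1 h2 h3 h4 h5 => ?_⟩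
  by_contra hlt
  exact hwin ⟨s, r, z, h1, h2, h3, h4, h5, not_lt.1 hlt⟩

/-! ### §5 (appended, LEAD g5) The dictionary entry for the wall board: W3 ⟺ W4 ∧ «apex flux decay» -/

section Dictionary

open Summit.NavierStokesRegularity.NavierStokesRegularity.Theorems.AxisTwistDoorTiltDominationLocDefs (OneSignedRigidity)
open Summit.NavierStokesRegularity.NavierStokesRegularity.Theorems.AxisTwistDoorTiltDominationLocEnergyClass
  (oneSignedRigidity_iff_core)

/-- **W3 ⟹ W4** inside the dictionary (the energy-class `PoloidalRigidity` is the `ω₃ ≡ 0` instance of `OneSignedRigidity`;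
cf. `…TiltDominationLocRigidity.oneSignedRigidity_iff`, not imported here). -/
theorem poloidalRigidity_of_oneSignedRigidity (h : OneSignedRigidity) : PoloidalRigidity := by
  rw [poloidalRigidity_iff_typeI]
  intro C v hrate hcont hmild hdiv hpol
  exact (oneSignedRigidity_iff_core.1 h) C v hrate hcont hmild hdiv (fun s hs y => (hpol s hs y).ge)

/-- **THE DICTIONARY ENTRY (wall board, row W3): `OneSignedRigidity` (⟺ crux 26991 `TiltDominationLoc`, by
`…TiltDominationLocRigidity.tiltDominationLoc_iff_oneSignedRigidity`) is EQUIVALENT to W4 (`PoloidalRigidity`) together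
with «every one-signed Type-I ancient Oseen-mild profile which is backward-singular at the apex has DECAYING APEX FLUX».**
(⟹: both conjuncts are vacuous consequences; ⟸: `not_isBackwardSingularPoint_of_fluxDecay_core`.)  So, modulo W4, the
crux is exactly apex flux decay — the quantity Lei–Ren–Tian's shell mechanism produces. [cite: LeiRenTian2025, §4
pp. 11–12] -/
theorem oneSignedRigidity_iff_poloidalRigidity_and_fluxDecay :
    OneSignedRigidity ↔
      (PoloidalRigidity ∧
        ∀ (C : ℝ) (v : ℝ → EuclideanSpace ℝ (Fin 3) → EuclideanSpace ℝ (Fin 3)),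
          HasTypeITimeDecay C v → ContinuousOn (uncurry v) (Iio (0 : ℝ) ×ˢ univ) →
          (∀ s t : ℝ, s < t → t < 0 → ∀ x,
            v t x = UnboundedOperators.heatExtension (v s) (t - s) x - oseenDuhamel 1 s v v t x) →
          (∀ t < 0, VectorCalculus.IsDivFree (v t)) → SignE3 v → IsBackwardSingularPoint v 0 → FluxDecay v) := by
  constructor
  · intro h
    refine ⟨poloidalRigidity_of_oneSignedRigidity h, fun C v hrate hcont hmild hdiv hsign hsing => ?_⟩
    exact absurd hsing ((oneSignedRigidity_iff_core.1 h) C v hrate hcont hmild hdiv hsign)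
  · rintro ⟨hP, hFD⟩
    rw [oneSignedRigidity_iff_core]
    intro C v hrate hcont hmild hdiv hsign hsing
    exact not_isBackwardSingularPoint_of_fluxDecay_core hP hrate hcont hmild hdiv hsign
      (hFD C v hrate hcont hmild hdiv hsign hsing) hsing

end Dictionary

end Summit.NavierStokesRegularity.NavierStokesRegularity.Theorems.AxisTwistDoorTiltDominationLocFluxNondecay

end
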